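import Mathlib
import Summits.NavierStokesRegularity.NavierStokesRegularity.Theorems.EulerZoomLiouvillePowerGaugeEulerLiouvilleDSSSimilarityPressure
import Summits.NavierStokesRegularity.NavierStokesRegularity.Theorems.EulerZoomLiouvillePowerGaugeEulerLiouvilleMovingSphereTrapping
import HarnessLib.Audit

/-!
# Crux E `PowerGaugeEulerLiouville` (stmt-NavierStokesRegularity-19832): A TAME DSS EULER FLOW WITH A SUB-BERNOULLI PRESSURE CLOCK CONTAINS AN
# EXACTLY SELF-SIMILAR PARTICLE PATH (portrait of the K-A″ residue; width seat ns-cas-k2 g2)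

Route `EulerZoomLiouville` (NavierStokesRegularity), crux E.  The positive content of the permanent-node mechanism of `…DSSSimilarityNodes`, extracted as a
structural theorem about hypothetical discretely self-similar Euler blow-ups — with NO class/gauge hypothesis and NO node hypothesis:
* `permanentNode_of_clusterPt` — along a backward trajectory of an `l`-DSS classical flow confined to a moving ball `‖x‖ ≤ R(−s)ⁿ` and AT REST in similarity
  variables (similarity speed `→ 0`), every cluster point `y*` of the similarity position `(−s)^{−n}X(s)` along times `s_j ≤ −j−1` is a PERMANENT NODE:
  `u(t, (−t)ⁿy*) = −n(−t)^{n−1}y*` for all `t < 0`, i.e. `t ↦ (−t)ⁿy*` is an exactly self-similar particle path;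
* `exists_permanentNode_of_rest` — hence such a trajectory produces a permanent node in the closed ball of radius `R`;
* `exists_selfSimilarPath_of_dss_of_clock` — **a classical Euler flow on `(−∞,0)` that is `l`-DSS (velocity and pressure class laws, `ρ > 0`), TAME (`u`, `∇u`
  bounded on compact time intervals) and satisfies the sub-Bernoulli pressure clock `(−s)∂ₛp − n⟪∇p,x⟩ − 2(1−n)p ≤ θ(1−2n)‖u + (n/(−s))x‖²` (`θ < 1`,
  `n = 1/(2+ρ)`) has an exactly self-similar particle path** (trapping `…MovingSphereTrapping` + rest `…DSSSimilarityBernoulliMember` + the above).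
Reading: in this stratum the whole difficulty of the DSS Liouville problem sits on the exactly self-similar particle paths (the K-A″ member theorems kill the
member as soon as those paths are subcritical).

WHAT THIS IS NOT: not NS regularity, not the crux E, not an existence statement for blow-up — a constraint on hypothetical DSS members. [folklore]
-/

noncomputable section

set_option linter.dupNamespace false

open MeasureTheory Set Filter Topology Metric Function
open scoped NNReal ENNReal ContDiff InnerProductSpace RealInnerProductSpace

namespace Summit.NavierStokesRegularity.NavierStokesRegularity.Theorems.PowerGaugeEulerLiouville.SimilarityBernoulli

open Literature.Analysis Literature.Analysis.FluidPDE Literature.Analysis.FunctionSpaces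
open Summit.NavierStokesRegularity.NavierStokesRegularity.Theorems.PowerGaugeEulerLiouville.VorticityBirth
open Summit.NavierStokesRegularity.NavierStokesRegularity.Theorems.PowerGaugeEulerLiouville.MovingSpherePiercing

variable {u : ℝ → EuclideanSpace ℝ (Fin 3) → EuclideanSpace ℝ (Fin 3)} {p : ℝ → EuclideanSpace ℝ (Fin 3) → ℝ} {θ ρ l : ℝ}

/-- **CLUSTER POINTS OF A RESTING CONFINED TRAJECTORY ARE PERMANENT NODES.**  `(u,p)` classical on `(−∞,0)`, `l`-DSS for the class scaling; `X` a particle path on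
`(−∞,0)` (`n = 1/(2+ρ)`) whose similarity speed tends to `0` at `−∞` (REST; no confinement needed here); times `s_j ≤ −j−1` along which the
similarity position `(−s_j)^{−n}X(s_j)` converges to `y*`.  Then `u(t, (−t)ⁿy*) = −n(−t)^{n−1}y*` for every `t < 0`. [folklore] -/
theorem permanentNode_of_clusterPt (hcl : IsClassicalEulerSolutionOn (Iio 0) 0 u p) (hl : 1 < l) (hρ : 0 < 2 + ρ)
    (hdss : ∀ τ : ℝ, τ < 0 → ∀ y, u τ y = (l ^ (1 + ρ)) • u ((l ^ (2 + ρ)) * τ) (l • y))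
    {X : ℝ → EuclideanSpace ℝ (Fin 3)} (hX : ∀ s : ℝ, s < 0 → HasDerivAt X (u s (X s)) s)
    (hrest : Tendsto (fun s => (-s) ^ (1 - (2 + ρ)⁻¹) * ‖u s (X s) + ((2 + ρ)⁻¹ / (-s)) • X s‖) atBot (𝓝 0))
    {sq : ℕ → ℝ} (hsqj : ∀ j, sq j ≤ -(j : ℝ) - 1) {ys : EuclideanSpace ℝ (Fin 3)}
    (hlim : Tendsto (fun j => ((-sq j) ^ (-(2 + ρ)⁻¹)) • X (sq j)) atTop (𝓝 ys)) {t : ℝ} (ht : t < 0) :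
    u t ((-t) ^ (2 + ρ)⁻¹ • ys) = (-((2 + ρ)⁻¹ * (-t) ^ ((2 + ρ)⁻¹ - 1))) • ys := by
  set n : ℝ := (2 + ρ)⁻¹ with hn
  set T : ℝ := l ^ (2 + ρ) with hT
  have hT1 : 1 < T := Real.one_lt_rpow hl hρ
  have hT0 : 0 < T := zero_lt_one.trans hT1
  have ht0' : 0 < -t := by linarith
  have hsq0 : ∀ j, sq j < 0 := fun j => by
    have := hsqj j; have h0 : (0:ℝ) ≤ j := Nat.cast_nonneg j; linarith
  have hneg_inv : ∀ s : ℝ, s < 0 → (-s) ^ (-n) = ((-s) ^ n)⁻¹ := fun s hs => Real.rpow_neg (by linarith) n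
  have hτ₀t : ∀ j : ℕ, (⌈-t⌉₊ : ℝ) ≤ j → sq j ≤ t := by
    intro j hj
    have h1 := hsqj j
    have h3 : (-t) ≤ (⌈-t⌉₊ : ℝ) := Nat.le_ceil (-t)
    linarith
  -- shift so that `s_{j+j₀} ≤ t`
  set j₀ : ℕ := ⌈-t⌉₊ with hj₀
  have hle : ∀ j : ℕ, sq (j + j₀) ≤ t := fun j => hτ₀t (j + j₀) (by push_cast; linarith [(Nat.cast_nonneg j : (0:ℝ) ≤ j)])
  choose m' hm'1 hm'2 using fun j => exists_pow_mul_mem_window hT1 ht (hle j)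
  set s' : ℕ → ℝ := fun j => T ^ (m' j) * t with hs'
  have hs'le : ∀ j, s' j ≤ sq (j + j₀) := fun j => (hm'2 j).le
  have hs'0 : ∀ j, s' j < 0 := fun j => lt_of_le_of_lt (hs'le j) (hsq0 _)
  set y' : ℕ → EuclideanSpace ℝ (Fin 3) := fun j => ((-s' j) ^ (-n)) • X (s' j) with hy'
  set G : EuclideanSpace ℝ (Fin 3) → EuclideanSpace ℝ (Fin 3) :=
    fun y => (-t) ^ (1 - n) • (u t ((-t) ^ n • y) + (n / (-t)) • ((-t) ^ n • y)) with hG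
  have hGV : ∀ j, G (y' j) = (-s' j) ^ (1 - n) • (u (s' j) (X (s' j)) + (n / (-s' j)) • X (s' j)) := by
    intro j
    have hp : 0 < (-s' j) ^ n := Real.rpow_pos_of_pos (by linarith [hs'0 j]) _
    have hx : l ^ (m' j) • ((-t) ^ n • y' j) = X (s' j) := by
      simp only [hy']
      rw [smul_smul, smul_smul, pow_mul_rpow_eq hl hρ (m' j) ht, ← hT, hneg_inv _ (hs'0 j), mul_inv_cancel₀ hp.ne',
        one_smul]
    have h := simVel_dss_iterate hl hρ hdss (m' j) ht ((-t) ^ n • y' j)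
    rw [hx, ← hT] at h
    simp only [hG]
    exact h.symm
  have hs'_bot : Tendsto s' atTop atBot := by
    have h1 : Tendsto (fun j : ℕ => -(j : ℝ) - 1) atTop atBot :=
      tendsto_atBot_add_const_right _ (-1) (tendsto_neg_atTop_atBot.comp tendsto_natCast_atTop_atTop)
    refine tendsto_atBot_mono (fun j => ?_) h1
    have h2 := hsqj (j + j₀)
    have h4 : (0 : ℝ) ≤ j₀ := Nat.cast_nonneg j₀
    push_cast at h2
    linarith [hs'le j]
  have hG0 : Tendsto (fun j => G (y' j)) atTop (𝓝 0) := by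
    refine tendsto_zero_iff_norm_tendsto_zero.2 ((hrest.comp hs'_bot).congr fun j => ?_)
    simp only [Function.comp_apply, hGV j, norm_smul, Real.norm_eq_abs,
      abs_of_nonneg (Real.rpow_nonneg (by linarith [hs'0 j] : (0:ℝ) ≤ -s' j) _)]
  have hdiff : Tendsto (fun j => ‖y' j - ((-sq (j + j₀)) ^ (-n)) • X (sq (j + j₀))‖) atTop (𝓝 0) := by
    rw [Metric.tendsto_atTop]
    intro ε hε
    have hε' : 0 < ε / (2 * T) := by positivity
    obtain ⟨N, hN⟩ := eventually_atBot.1 (hrest.eventually (gt_mem_nhds hε'))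
    refine ⟨⌈-N⌉₊, fun j hj => ?_⟩
    rw [dist_zero_right, norm_norm]
    have hsN : sq (j + j₀) ≤ N := by
      have h2 := hsqj (j + j₀)
      have h4 : (-N) ≤ (⌈-N⌉₊ : ℝ) := Nat.le_ceil (-N)
      have h5 : (⌈-N⌉₊ : ℝ) ≤ j := by exact_mod_cast hj
      have h6 : (0 : ℝ) ≤ j₀ := Nat.cast_nonneg j₀
      push_cast at h2
      linarith
    have hmv := norm_simPos_sub_le (n := n) (T := T) (ε := ε / (2 * T)) (hsq0 (j + j₀)) (hs'le j) (hm'1 j) hX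
      (fun σ hσ => by
        rw [norm_smul, Real.norm_eq_abs, abs_of_nonneg (Real.rpow_nonneg (by linarith [hσ.2, hsq0 (j + j₀)]) _)]
        exact (hN σ (hσ.2.trans hsN)).le)
    rw [← norm_neg, neg_sub] at hmv
    simp only [hy']
    refine lt_of_le_of_lt hmv ?_
    rw [div_mul_eq_mul_div, div_lt_iff₀ (by positivity)]
    nlinarith
  have hy'lim : Tendsto y' atTop (𝓝 ys) := by
    have hyφ : Tendsto (fun j => ((-sq (j + j₀)) ^ (-n)) • X (sq (j + j₀))) atTop (𝓝 ys) :=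
      hlim.comp (tendsto_add_atTop_nat j₀)
    rw [tendsto_iff_norm_sub_tendsto_zero] at hyφ ⊢
    refine squeeze_zero (fun j => norm_nonneg _) (fun j => ?_) (hdiff.add hyφ |>.trans_eq (by simp))
    calc ‖y' j - ys‖ = ‖(y' j - ((-sq (j + j₀)) ^ (-n)) • X (sq (j + j₀))) +
          (((-sq (j + j₀)) ^ (-n)) • X (sq (j + j₀)) - ys)‖ := by rw [sub_add_sub_cancel]
      _ ≤ _ := norm_add_le _ _
  have hGc : Continuous G := by
    have hu : Continuous (u t) := ((hcl.contDiff_velocity (mem_Iio.2 ht)).of_le (by norm_cast)).continuous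
    simp only [hG]
    exact ((hu.comp (continuous_id.const_smul ((-t) ^ n))).add
      ((continuous_id.const_smul ((-t) ^ n)).const_smul (n / (-t)))).const_smul ((-t) ^ (1 - n))
  have hGys : G ys = 0 := tendsto_nhds_unique ((hGc.tendsto ys).comp hy'lim) hG0
  have hpow0 : (-t) ^ (1 - n) ≠ 0 := (Real.rpow_pos_of_pos ht0' _).ne'
  simp only [hG, smul_eq_zero, hpow0, false_or] at hGys
  rw [eq_neg_of_add_eq_zero_left hGys, smul_smul, ← neg_smul, Real.rpow_sub_one ht0'.ne']
  congr 1
  field_simp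

/-- **A RESTING CONFINED TRAJECTORY OF A DSS FLOW PRODUCES A PERMANENT NODE** in the closed ball of radius `R`. [folklore] -/
theorem exists_permanentNode_of_rest (hcl : IsClassicalEulerSolutionOn (Iio 0) 0 u p) (hl : 1 < l) (hρ : 0 < 2 + ρ)
    (hdss : ∀ τ : ℝ, τ < 0 → ∀ y, u τ y = (l ^ (1 + ρ)) • u ((l ^ (2 + ρ)) * τ) (l • y))
    {X : ℝ → EuclideanSpace ℝ (Fin 3)} {τ₀ R : ℝ} (hX : ∀ s : ℝ, s < 0 → HasDerivAt X (u s (X s)) s)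
    (hconf : ∀ s : ℝ, s ≤ τ₀ → ‖X s‖ ≤ R * (-s) ^ (2 + ρ)⁻¹)
    (hrest : Tendsto (fun s => (-s) ^ (1 - (2 + ρ)⁻¹) * ‖u s (X s) + ((2 + ρ)⁻¹ / (-s)) • X s‖) atBot (𝓝 0)) :
    ∃ ys : EuclideanSpace ℝ (Fin 3), ‖ys‖ ≤ R ∧
      ∀ t : ℝ, t < 0 → u t ((-t) ^ (2 + ρ)⁻¹ • ys) = (-((2 + ρ)⁻¹ * (-t) ^ ((2 + ρ)⁻¹ - 1))) • ys := by
  set n : ℝ := (2 + ρ)⁻¹ with hn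
  set sq : ℕ → ℝ := fun j => min τ₀ (-(j : ℝ) - 1) with hsq
  have hsqτ : ∀ j, sq j ≤ τ₀ := fun j => min_le_left _ _
  have hsqj : ∀ j, sq j ≤ -(j : ℝ) - 1 := fun j => min_le_right _ _
  have hsq0 : ∀ j, sq j < 0 := fun j => by
    have := hsqj j; have h0 : (0:ℝ) ≤ j := Nat.cast_nonneg j; linarith
  set yq : ℕ → EuclideanSpace ℝ (Fin 3) := fun j => ((-sq j) ^ (-n)) • X (sq j) with hyq
  have hyqR : ∀ j, yq j ∈ closedBall (0 : EuclideanSpace ℝ (Fin 3)) R := by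
    intro j
    have hs0 : 0 < -sq j := by linarith [hsq0 j]
    have hp : 0 < (-sq j) ^ n := Real.rpow_pos_of_pos hs0 _
    rw [mem_closedBall_zero_iff]
    simp only [hyq]
    rw [norm_smul, Real.norm_eq_abs, Real.rpow_neg hs0.le, abs_of_pos (inv_pos.2 hp), inv_mul_le_iff₀ hp, mul_comm]
    exact hconf (sq j) (hsqτ j)
  obtain ⟨ys, hys, φ, hφ, hlim⟩ := (isCompact_closedBall (0 : EuclideanSpace ℝ (Fin 3)) R).tendsto_subseq hyqR
  refine ⟨ys, mem_closedBall_zero_iff.1 hys, fun t ht => ?_⟩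
  have hφge : ∀ j : ℕ, (j : ℝ) ≤ (φ j : ℝ) := fun j => by exact_mod_cast hφ.id_le j
  exact permanentNode_of_clusterPt hcl hl hρ hdss hX hrest (sq := sq ∘ φ)
    (fun j => (hsqj (φ j)).trans (by linarith [hφge j])) hlim ht

/-- **A TAME DSS EULER FLOW WITH A SUB-BERNOULLI PRESSURE CLOCK HAS AN EXACTLY SELF-SIMILAR PARTICLE PATH.**  `(u,p)` classical Euler on `(−∞,0)`, `l`-DSS for
the class scaling of exponent `ρ > 0` (velocity AND pressure laws), `u`, `∇u` bounded on compact time intervals, and the sub-Bernoulli pressure clock with `θ < 1`.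
Then there is `y*` with `u(t, (−t)ⁿy*) = −n(−t)^{n−1}y*` for all `t < 0` (`n = 1/(2+ρ)`): the ray path `t ↦ (−t)ⁿy*` is a particle path.  No class or gauge
hypothesis is used. [folklore] -/
theorem exists_selfSimilarPath_of_dss_of_clock (hcl : IsClassicalEulerSolutionOn (Iio 0) 0 u p) (hρ : 0 < ρ) (hl : 1 < l)
    (hdss : ∀ τ : ℝ, τ < 0 → ∀ y, u τ y = (l ^ (1 + ρ)) • u ((l ^ (2 + ρ)) * τ) (l • y))
    (hpdss : ∀ τ : ℝ, τ < 0 → ∀ y, p τ y = l ^ (2 + 2 * ρ) * p ((l ^ (2 + ρ)) * τ) (l • y))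
    (htame : ∀ s t : ℝ, s < t → t < 0 → ∃ B : ℝ, ∀ τ ∈ Icc s t, ∀ y : EuclideanSpace ℝ (Fin 3),
      ‖u τ y‖ ≤ B ∧ ‖fderiv ℝ (u τ) y‖ ≤ B)
    (hθ : θ < 1)
    (hclock : ∀ s : ℝ, s < 0 → ∀ x : EuclideanSpace ℝ (Fin 3),
      (-s) * timeDerivWithin (Iio 0) p s x - (2 + ρ)⁻¹ * fderiv ℝ (p s) x x - 2 * (1 - (2 + ρ)⁻¹) * p s x ≤
        θ * (1 - 2 * (2 + ρ)⁻¹) * ‖u s x + ((2 + ρ)⁻¹ / (-s)) • x‖ ^ 2) :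
    ∃ ys : EuclideanSpace ℝ (Fin 3),
      ∀ t : ℝ, t < 0 → u t ((-t) ^ (2 + ρ)⁻¹ • ys) = (-((2 + ρ)⁻¹ * (-t) ^ ((2 + ρ)⁻¹ - 1))) • ys := by
  have hρ2 : 0 < 2 + ρ := by linarith
  have hl0 : 0 < l := zero_lt_one.trans hl
  set n : ℝ := (2 + ρ)⁻¹ with hn
  have hn0 : 0 < n := inv_pos.2 hρ2
  have hn2 : n < 1 / 2 := by
    rw [hn, inv_lt_comm₀ hρ2 (by norm_num)]; norm_num; linarith
  -- global Type-I bounds from tameness on one period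
  obtain ⟨B, hB⟩ := htame (-(l ^ (2 + ρ))) (-1) (by linarith [Real.one_lt_rpow hl hρ2]) (by norm_num)
  have hK := exists_typeI_of_dss_tame hl hρ2 (by linarith) hdss hB
  set K : ℝ := l ^ (2 + ρ) * B with hKdef
  have hΛc : ContinuousOn (fun s : ℝ => K / (-s)) (Iio 0) :=
    continuousOn_const.div continuousOn_neg fun s hs => by rw [mem_Iio] at hs; linarith
  have hΛ : ∀ s : ℝ, s < 0 → ∀ y, ‖fderiv ℝ (u s) y‖ ≤ K / (-s) := fun s hs y => by
    rw [le_div_iff₀ (by linarith), mul_comm]; exact (hK s hs y).1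
  have hlip : ODE.IsUniformlyLipschitzOn u (Iio 0) := isUniformlyLipschitzOn hcl hΛc hΛ
  -- the trajectory of the origin from time `−1`, trapped in the moving ball of radius `R = K/n + 1`
  set R : ℝ := K / n + 1 with hR
  have hbR : K < n * R := by
    have : K / n < R := by rw [hR]; linarith
    rwa [div_lt_iff₀ hn0, mul_comm] at this
  have hτ₀ : (-1 : ℝ) < 0 := by norm_num
  set X : ℝ → EuclideanSpace ℝ (Fin 3) := fun s => ODE.evolutionMap u (-1) s 0 with hX
  have hXd : ∀ s : ℝ, s < 0 → HasDerivAt X (u s (X s)) s := fun s hs =>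
    hlip.hasDerivAt_evolutionMap (convex_Iio 0) hτ₀ (Iio_mem_nhds hs) 0
  have hK0 : 0 ≤ K := le_trans (mul_nonneg (by norm_num) (norm_nonneg _)) (hK (-1) hτ₀ 0).1
  have hx₀ : ‖(0 : EuclideanSpace ℝ (Fin 3))‖ < R * (-(-1 : ℝ)) ^ n := by
    rw [norm_zero, neg_neg, Real.one_rpow, mul_one, hR]; positivity
  have hconf : ∀ s : ℝ, s ≤ -1 → ‖X s‖ ≤ R * (-s) ^ n := fun s hs =>
    (confined_of_boundedSpeed hcl hΛc hΛ hbR hτ₀ (fun σ hσ x _ => (hK σ (by linarith) x).2) hx₀ hs).le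
  obtain ⟨P₀, G, hPG⟩ := exists_pressure_core_bounds_of_dss hcl.smooth_pressure hl hρ2 hpdss R
  have hrest := tendsto_similaritySpeed_zero_of_clock hcl hn0.le hn2 hθ hclock hτ₀ hXd hconf
    (fun s hs => (hK s (by linarith) (X s)).2) (fun s hs => (hPG s (by linarith) (X s) (hconf s hs)).1)
    (fun s hs => (hPG s (by linarith) (X s) (hconf s hs)).2)
  obtain ⟨ys, -, hys⟩ := exists_permanentNode_of_rest hcl hl hρ2 hdss hXd hconf hrest
  exact ⟨ys, hys⟩

end Summit.NavierStokesRegularity.NavierStokesRegularity.Theorems.PowerGaugeEulerLiouville.SimilarityBernoulli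

end
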